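import Summits.CriticalPhenomena.PercolationContinuityZ3.Theorems.PercThresholdOneFragileWeavingGiantExistsWeave

/-!
# `FragileWeavingGiantExists` (stmt-CriticalPhenomena-5266) — the probability space, Haar invariance, the good event, equivariance

Part of the proof of support item `FragileWeavingGiantExists` of route `PercThresholdOne` by the stationary
hierarchical spanning tree of `ℤ³` (see `PercThresholdOneFragileWeavingGiantExistsDefs.lean` for the construction and the overview).
-/

noncomputable section

namespace Summit.CriticalPhenomena.PercolationContinuityZ3.Theorems.FragileGiant

open MeasureTheory
open scoped ENNReal
open Literature.Probability.Percolation Literature.Probability.LatticeModels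
open Literature.Probability.Percolation.DCT16

/-- The raw digit prefix map is measurable. -/
theorem measurable_Dn (n : ℕ) : Measurable (Dn n) :=
  measurable_pi_lambda _ fun m => measurable_pi_apply (m : ℕ)

/-- **Measure of a full cylinder**: `27^{-n}`. -/
theorem μ_Dn_eq (n : ℕ) (g : Fin n → P) : μ {ω | Dn n ω = g} = 27⁻¹ ^ n := by
  have hset : {ω : Ω | Dn n ω = g} = Set.pi ↑(Finset.range n) (fun m => {extω n g m}) := by
    ext ω
    simp only [Set.mem_setOf_eq, Set.mem_pi, Finset.mem_coe, Finset.mem_range, Set.mem_singleton_iff]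
    constructor
    · rintro rfl m hm; simp [Dn, extω, hm]
    · intro h; funext m; have := h m m.2; simp [extω, m.2] at this; exact this
  rw [hset, μ, Measure.infinitePi_pi _ (fun _ _ => (Set.toFinite _).measurableSet)]
  simp [unifP_singleton]

/-- **Counting formula**: the probability that the digit prefix satisfies a property is the proportion of
digit strings satisfying it. -/
theorem μ_setOf_Dn (n : ℕ) (Q : (Fin n → P) → Prop) [DecidablePred Q] :
    μ {ω | Q (Dn n ω)} = (Finset.univ.filter Q).card * 27⁻¹ ^ n := by
  have hset : {ω : Ω | Q (Dn n ω)} = ⋃ g ∈ Finset.univ.filter Q, {ω | Dn n ω = g} := by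
    ext ω; simp
  rw [hset, measure_biUnion_finset]
  · simp [μ_Dn_eq]
  · intro g _ g' _ hne
    exact Set.disjoint_left.2 fun ω h1 h2 => hne (h1.symm.trans h2)
  · intro g _
    exact (measurableSet_singleton g).preimage (measurable_Dn n)

/-- Partial sums only see the raw digits below their index. -/
theorem psum_congr {ω ω' : Ω} {n : ℕ} (h : ∀ k < n, ω k = ω' k) {j : ℕ} (hj : j ≤ n) (i : Fin 3) :
    psum ω j i = psum ω' j i :=
  Finset.sum_congr rfl fun k hk => by rw [h k (lt_of_lt_of_le (Finset.mem_range.1 hk) hj)]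

/-- Digits below level `n` only see the raw digits below `n`. -/
theorem digit_congr {ω ω' : Ω} {n : ℕ} (h : ∀ k < n, ω k = ω' k) (x : V3) {m : ℕ} (hm : m < n) :
    digit ω x m = digit ω' x m := by
  funext i; simp only [digit, psum_congr h (Nat.succ_le_of_lt hm)]

/-- The digits of a raw partial sum are the raw digits. -/
theorem zdigit_psum (ω : Ω) {m n : ℕ} (hm : m < n) (i : Fin 3) : zdigit (psum ω n i) m = ω m i := by
  rw [psum_eq_add_mul ω (Nat.succ_le_of_lt hm) i, zdigit_add_mul]
  apply Fin.ext
  have h1 := zdigit_val (psum ω (m + 1) i) m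
  have hq : psum ω (m + 1) i / 3 ^ m = ((ω m i : ℕ) : ℤ) :=
    ((Int.ediv_emod_unique (three_pow_pos m)).2
      ⟨by rw [psum_succ]; ring, psum_nonneg ω m i, psum_lt ω m i⟩).1
  rw [hq, Int.emod_eq_of_lt (by positivity) (by have := (ω m i).isLt; omega)] at h1
  exact_mod_cast h1

/-- Factorisation of the digits of `v` through the raw digit prefix. -/
theorem digit_eq_βmap (v : V3) (n : ℕ) (ω : Ω) (m : Fin n) : digit ω v m = βmap v n (Dn n ω) m :=
  digit_congr (fun k hk => by simp [extω, Dn, hk]) v m.2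

/-- `rel` is determined by the digits below its level. -/
theorem rel_eq_of_digit_eq {ω ω' : Ω} {v : V3} {n : ℕ} (h : ∀ m < n, digit ω v m = digit ω' v m) (i : Fin 3) :
    rel ω n v i = rel ω' n v i := by
  induction n with
  | zero => simp [rel]
  | succ n ih =>
    rw [rel_succ, rel_succ, ih (fun m hm => h m (Nat.lt_succ_of_lt hm)), h n (Nat.lt_succ_self n)]

/-- **The digit-string map is injective** (hence bijective). -/
theorem βmap_injective (v : V3) (n : ℕ) : Function.Injective (βmap v n) := by
  intro g g' hgg'
  have hd : ∀ m < n, digit (extω n g) v m = digit (extω n g') v m := fun m hm => by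
    have := congr_fun hgg' ⟨m, hm⟩; exact this
  have hps : ∀ i, psum (extω n g) n i = psum (extω n g') n i := by
    intro i
    have hr := rel_eq_of_digit_eq hd i
    simp only [rel] at hr
    have hdvd : (3 : ℤ) ^ n ∣ psum (extω n g') n i - psum (extω n g) n i := by
      have := Int.ModEq.dvd hr
      simpa using this
    have habs : |psum (extω n g') n i - psum (extω n g) n i| < 3 ^ n := by
      rw [abs_sub_lt_iff]
      constructor <;> linarith [psum_nonneg (extω n g) n i, psum_lt (extω n g) n i,
        psum_nonneg (extω n g') n i, psum_lt (extω n g') n i]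
    linarith [Int.eq_zero_of_abs_lt_dvd hdvd habs]
  funext m i
  have h1 := zdigit_psum (extω n g) m.2 i
  have h2 := zdigit_psum (extω n g') m.2 i
  simp only [extω, m.2, dif_pos] at h1 h2
  rw [← h1, ← h2, hps]

/-- The digit-string map is a bijection of the finite set of digit strings. -/
theorem βmap_bijective (v : V3) (n : ℕ) : Function.Bijective (βmap v n) :=
  (Finite.injective_iff_bijective).1 (βmap_injective v n)

/-- Digits are measurable functions of the randomness. -/
theorem measurable_digit (x : V3) (m : ℕ) : Measurable fun ω : Ω => digit ω x m := by
  have : (fun ω : Ω => digit ω x m) = (fun g : Fin (m + 1) → P => βmap x (m + 1) g ⟨m, Nat.lt_succ_self m⟩) ∘ Dn (m + 1) := by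
    funext ω; exact digit_eq_βmap x (m + 1) ω ⟨m, Nat.lt_succ_self m⟩
  rw [this]
  exact (measurable_of_finite _).comp (measurable_Dn _)

/-- The odometer is measurable. -/
theorem measurable_addω (v : V3) : Measurable (addω v) :=
  measurable_pi_lambda _ fun m => measurable_digit v m

/-- **Haar invariance**: the odometer preserves `μ`. -/
theorem map_addω (v : V3) : μ.map (addω v) = μ := by
  classical
  refine Measure.eq_infinitePi _ fun s t ht => ?_
  set n := s.sup id + 1 with hn
  have hsn : ∀ m ∈ s, m < n := fun m hm => Nat.lt_succ_of_le (Finset.le_sup (f := id) hm)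
  let Q : (Fin n → P) → Prop := fun g => ∀ m : Fin n, (m : ℕ) ∈ s → g m ∈ t m
  have hpre : addω v ⁻¹' Set.pi ↑s t = {ω | Q (βmap v n (Dn n ω))} := by
    ext ω
    simp only [Set.mem_preimage, Set.mem_pi, Finset.mem_coe, Set.mem_setOf_eq, Q, ← digit_eq_βmap]
    constructor
    · intro h m hm; exact h m hm
    · intro h m hm; exact h ⟨m, hsn m hm⟩ hm
  have hpi : Set.pi ↑s t = {ω : Ω | Q (Dn n ω)} := by
    ext ω
    simp only [Set.mem_pi, Finset.mem_coe, Set.mem_setOf_eq, Q, Dn]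
    constructor
    · intro h m hm; exact h m hm
    · intro h m hm; exact h ⟨m, hsn m hm⟩ hm
  have hcard : (Finset.univ.filter (fun g => Q (βmap v n g))).card = (Finset.univ.filter Q).card := by
    have himage : (Finset.univ.filter (fun g => Q (βmap v n g))).image (βmap v n) = Finset.univ.filter Q := by
      ext g
      simp only [Finset.mem_image, Finset.mem_filter, Finset.mem_univ, true_and]
      constructor
      · rintro ⟨g', hg', rfl⟩; exact hg'
      · intro hg
        obtain ⟨g', rfl⟩ := (βmap_bijective v n).2 g
        exact ⟨g', hg, rfl⟩
    rw [← himage, Finset.card_image_of_injective _ (βmap_injective v n)]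
  have h1 := μ_setOf_Dn n (fun g => Q (βmap v n g))
  have h2 := μ_setOf_Dn n Q
  rw [Measure.map_apply (measurable_addω v) (MeasurableSet.pi s.countable_toSet fun i _ => ht i), hpre,
    h1, hcard, ← h2, ← hpi, μ, Measure.infinitePi_pi _ fun i _ => ht i]

/-- Partial sums of the odometer image are the residues of `v + S(ω)`. -/
theorem psum_addω (v : V3) (ω : Ω) (n : ℕ) (i : Fin 3) : psum (addω v ω) n i = (v i + psum ω n i) % 3 ^ n := by
  induction n with
  | zero => simp [psum]
  | succ n ih =>
    rw [psum_succ, ih, emod_pow_succ, psum_succ, ← add_assoc, Int.add_mul_emod_self_right]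
    congr 1
    show ((digit ω v n i : ℕ) : ℤ) * 3 ^ n = _
    rw [digit_val, psum_succ, ← add_assoc]

/-- **Equivariance of digits**: the digits of `x` for the shifted randomness are the digits of `x + v`. -/
theorem digit_addω (v : V3) (ω : Ω) (x : V3) (m : ℕ) : digit (addω v ω) x m = digit ω (x + v) m := by
  funext i
  simp only [digit, psum_addω, Pi.add_apply]
  have h1 := Int.emod_add_mul_ediv (v i + psum ω (m + 1) i) (3 ^ (m + 1))
  rw [show x i + (v i + psum ω (m + 1) i) % 3 ^ (m + 1) =
      (x i + v i + psum ω (m + 1) i) + (-((v i + psum ω (m + 1) i) / 3 ^ (m + 1))) * 3 ^ (m + 1) by linarith,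
    zdigit_add_mul]

/-- The probability of avoiding a digit vector at `J` consecutive levels is `(26/27)^J`. -/
theorem μ_forall_digit_ne_le (x : V3) (b : P) (M J : ℕ) :
    μ {ω | ∀ m, M ≤ m → digit ω x m ≠ b} ≤ (26 * 27⁻¹ : ℝ≥0∞) ^ J := by
  classical
  have hsub : {ω : Ω | ∀ m, M ≤ m → digit ω x m ≠ b} ⊆
      addω x ⁻¹' Set.pi ↑(Finset.Ico M (M + J)) (fun _ => ({b}ᶜ : Set P)) := by
    intro ω hω
    simp only [Set.mem_preimage, Set.mem_pi, Finset.mem_coe, Finset.mem_Ico, Set.mem_compl_iff,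
      Set.mem_singleton_iff]
    intro m hm
    exact hω m hm.1
  refine (measure_mono hsub).trans ?_
  rw [← Measure.map_apply (measurable_addω x) (MeasurableSet.pi (Finset.countable_toSet _)
    fun _ _ => (Set.toFinite _).measurableSet), map_addω, μ,
    Measure.infinitePi_pi _ fun _ _ => (Set.toFinite _).measurableSet]
  simp only [Finset.prod_const, Nat.card_Ico, Nat.add_sub_cancel_left]
  gcongr
  rw [unifP_apply, Measure.count_apply_finite _ (Set.toFinite _)]
  have : (Set.toFinite ({b}ᶜ : Set P)).toFinset.card = 26 := by
    rw [Set.toFinite_toFinset, Set.toFinset_compl, Finset.card_compl, Set.toFinset_singleton,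
      Finset.card_singleton, card_P]
  rw [this, mul_comm]
  norm_num

/-- Avoiding a digit vector forever has probability zero. -/
theorem μ_forall_digit_ne (x : V3) (b : P) (M : ℕ) : μ {ω | ∀ m, M ≤ m → digit ω x m ≠ b} = 0 := by
  refine le_antisymm ?_ bot_le
  have hlt : (26 * 27⁻¹ : ℝ≥0∞) < 1 := by
    rw [← div_eq_mul_inv, ENNReal.div_lt_iff (Or.inl (by norm_num)) (Or.inl (by norm_num)), one_mul]
    norm_num
  have ht : Filter.Tendsto (fun J : ℕ => (26 * 27⁻¹ : ℝ≥0∞) ^ J) Filter.atTop (nhds 0) :=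
    ENNReal.tendsto_pow_atTop_nhds_zero_of_lt_one hlt
  exact ge_of_tendsto' ht fun J => μ_forall_digit_ne_le x b M J

/-- **The good event has full measure.** -/
theorem ae_mem_goodSet : ∀ᵐ ω ∂μ, ω ∈ goodSet := by
  have hcompl : goodSetᶜ = ⋃ x : V3, ⋃ b : P, ⋃ M : ℕ, {ω | ∀ m, M ≤ m → digit ω x m ≠ b} := by
    ext ω
    simp only [goodSet, Set.mem_compl_iff, Set.mem_setOf_eq, Set.mem_iUnion, not_forall, not_exists, not_and]
  rw [ae_iff]
  change μ {ω | ¬ω ∈ goodSet} = 0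
  rw [show {ω | ¬ω ∈ goodSet} = goodSetᶜ from rfl, hcompl]
  refine measure_iUnion_null fun x => measure_iUnion_null fun b => measure_iUnion_null fun M => ?_
  exact μ_forall_digit_ne x b M

/-- The first synchronising level depends only on the digit sequence. -/
theorem syncLevel_congr {ω ω' : Ω} {x x' : V3} (h : ∀ m, digit ω x m = digit ω' x' m) (m : ℕ) :
    syncLevel ω x m = syncLevel ω' x' m := by
  unfold syncLevel
  have hiff : (∃ j, isSync (digit ω x (m + j)) = true) ↔ ∃ j, isSync (digit ω' x' (m + j)) = true := by
    simp only [h]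
  by_cases hy : ∃ j, isSync (digit ω x (m + j)) = true
  · rw [dif_pos hy, dif_pos (hiff.1 hy)]
    apply le_antisymm
    · exact Nat.find_min' hy (by rw [h]; exact Nat.find_spec (hiff.1 hy))
    · exact Nat.find_min' _ (by rw [← h]; exact Nat.find_spec hy)
  · rw [dif_neg hy, dif_neg (mt hiff.2 hy)]

/-- The exit types depend only on the digit sequence. -/
theorem exitType_congr {ω ω' : Ω} {x x' : V3} (h : ∀ m, digit ω x m = digit ω' x' m) (m : ℕ) :
    exitType ω x m = exitType ω' x' m := by
  have haux : ∀ j m', exitTypeAux ω x m' j = exitTypeAux ω' x' m' j := by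
    intro j
    induction j with
    | zero => intro m'; simp [exitTypeAux, h m']
    | succ j ih => intro m'; simp [exitTypeAux, h m', ih (m' + 1)]
  rw [exitType, exitType, syncLevel_congr h, haux]

/-- The jump level depends only on the digit sequence. -/
theorem jlev_congr {ω ω' : Ω} {x x' : V3} (h : ∀ m, digit ω x m = digit ω' x' m) : jlev ω x = jlev ω' x' := by
  unfold jlev
  have hp : ∀ m, (digit ω x m ≠ pos (exitType ω x (m + 1))) ↔ (digit ω' x' m ≠ pos (exitType ω' x' (m + 1))) := by
    intro m; rw [h m, exitType_congr h]
  have hiff : (∃ m, digit ω x m ≠ pos (exitType ω x (m + 1))) ↔ ∃ m, digit ω' x' m ≠ pos (exitType ω' x' (m + 1)) :=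
    exists_congr hp
  by_cases hy : ∃ m, digit ω x m ≠ pos (exitType ω x (m + 1))
  · rw [dif_pos hy, dif_pos (hiff.1 hy)]
    apply le_antisymm
    · exact Nat.find_min' hy ((hp _).2 (Nat.find_spec (hiff.1 hy)))
    · exact Nat.find_min' _ ((hp _).1 (Nat.find_spec hy))
  · rw [dif_neg hy, dif_neg (mt hiff.2 hy)]

/-- The parent direction depends only on the digit sequence. -/
theorem parDir_congr {ω ω' : Ω} {x x' : V3} (h : ∀ m, digit ω x m = digit ω' x' m) : parDir ω x = parDir ω' x' := by
  unfold parDir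
  rw [jlev_congr h, h, exitType_congr h]

/-- **Equivariance of the parent map** under the odometer. -/
theorem par_addω (v : V3) (ω : Ω) (x : V3) : par (addω v ω) x = par ω (x + v) - v := by
  unfold par
  rw [parDir_congr (fun m => digit_addω v ω x m)]
  abel

/-- **Equivariance of the tree**: shifting the randomness by `v` translates the tree by `-v`. -/
theorem treeConfig_addω (v : V3) (ω : Ω) : treeConfig (addω v ω) = Sym2.map (· + v) ⁻¹' treeConfig ω := by
  ext e
  simp only [Set.mem_preimage, mem_treeConfig_iff]
  constructor
  · rintro ⟨x, rfl⟩
    refine ⟨x + v, ?_⟩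
    simp [par_addω]
  · rintro ⟨y, hy⟩
    induction e using Sym2.ind with
    | h a b =>
      simp only [Sym2.map_mk, Sym2.eq_iff] at hy
      rcases hy with ⟨h1, h2⟩ | ⟨h1, h2⟩
      · refine ⟨a, ?_⟩
        rw [par_addω, ← h1, h2, add_sub_cancel_right]
      · refine ⟨b, ?_⟩
        rw [par_addω, ← h1, h2, add_sub_cancel_right, Sym2.eq_swap]

/-- Preimages of digit values are measurable. -/
theorem measurableSet_digit_mem (x : V3) (m : ℕ) (A : Set P) : MeasurableSet {ω : Ω | digit ω x m ∈ A} :=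
  (measurable_digit x m) (Set.toFinite A).measurableSet

/-- The synchronising level is measurable. -/
theorem measurable_syncLevel (x : V3) (m : ℕ) : Measurable fun ω : Ω => syncLevel ω x m := by
  classical
  let p : Ω → ℕ → Prop := fun ω j =>
    isSync (digit ω x (m + j)) = true ∨ ¬∃ j, isSync (digit ω x (m + j)) = true
  have hp : ∀ ω, ∃ j, p ω j := fun ω => by
    by_cases h : ∃ j, isSync (digit ω x (m + j)) = true
    · obtain ⟨j, hj⟩ := h; exact ⟨j, Or.inl hj⟩
    · exact ⟨0, Or.inr h⟩
  have hb : ∀ j, MeasurableSet {ω : Ω | isSync (digit ω x (m + j)) = true} := fun j =>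
    measurableSet_digit_mem x (m + j) {a | isSync a = true}
  have hE : MeasurableSet {ω : Ω | ∃ j, isSync (digit ω x (m + j)) = true} := by
    rw [Set.setOf_exists]; exact MeasurableSet.iUnion hb
  have hm : ∀ k, MeasurableSet {ω | p ω k} := fun k => (hb k).union hE.compl
  have key : (fun ω => syncLevel ω x m) = fun ω => Nat.find (hp ω) := by
    funext ω
    unfold syncLevel
    by_cases h : ∃ j, isSync (digit ω x (m + j)) = true
    · rw [dif_pos h]
      have hiff : ∀ j, p ω j ↔ isSync (digit ω x (m + j)) = true := fun j =>
        ⟨fun hj => hj.resolve_right (not_not.2 h), Or.inl⟩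
      apply le_antisymm
      · exact Nat.find_min' h ((hiff _).1 (Nat.find_spec (hp ω)))
      · exact Nat.find_min' (hp ω) ((hiff _).2 (Nat.find_spec h))
    · rw [dif_neg h]
      symm
      rw [Nat.find_eq_zero]
      exact Or.inr h
  rw [key]
  exact measurable_find hp hm

/-- Level sets of the fuelled exit types are measurable. -/
theorem measurableSet_exitTypeAux_eq (x : V3) (l m : ℕ) (t : K4) :
    MeasurableSet {ω : Ω | exitTypeAux ω x m l = t} := by
  induction l generalizing m t with
  | zero => exact measurableSet_digit_mem x m {a | syncVal a = t}
  | succ l ih =>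
    have : {ω : Ω | exitTypeAux ω x m (l + 1) = t} =
        ⋃ t' : K4, {ω | exitTypeAux ω x (m + 1) l = t'} ∩ {ω | digit ω x m ∈ {a | nextType a t' = t}} := by
      ext ω
      simp only [exitTypeAux, Set.mem_setOf_eq, Set.mem_iUnion, Set.mem_inter_iff]
      constructor
      · intro h; exact ⟨_, rfl, h⟩
      · rintro ⟨t', rfl, h⟩; exact h
    rw [this]
    exact MeasurableSet.iUnion fun t' => (ih (m + 1) t').inter (measurableSet_digit_mem x m _)

/-- Level sets of the exit types are measurable. -/
theorem measurableSet_exitType_eq (x : V3) (m : ℕ) (t : K4) : MeasurableSet {ω : Ω | exitType ω x m = t} := by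
  have : {ω : Ω | exitType ω x m = t} =
      ⋃ l : ℕ, {ω | syncLevel ω x m = l} ∩ {ω | exitTypeAux ω x m l = t} := by
    ext ω
    simp only [exitType, Set.mem_setOf_eq, Set.mem_iUnion, Set.mem_inter_iff]
    constructor
    · intro h; exact ⟨_, rfl, h⟩
    · rintro ⟨l, rfl, h⟩; exact h
  rw [this]
  exact MeasurableSet.iUnion fun l =>
    ((measurable_syncLevel x m) (measurableSet_singleton l)).inter (measurableSet_exitTypeAux_eq x l m t)

/-- Joint level sets of a digit and an exit type are measurable. -/
theorem measurableSet_digit_exitType (x : V3) (m m' : ℕ) (R : P → K4 → Prop) :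
    MeasurableSet {ω : Ω | R (digit ω x m) (exitType ω x m')} := by
  have : {ω : Ω | R (digit ω x m) (exitType ω x m')} =
      ⋃ t : K4, {ω | exitType ω x m' = t} ∩ {ω | digit ω x m ∈ {a | R a t}} := by
    ext ω
    simp only [Set.mem_setOf_eq, Set.mem_iUnion, Set.mem_inter_iff]
    constructor
    · intro h; exact ⟨_, rfl, h⟩
    · rintro ⟨t, rfl, h⟩; exact h
  rw [this]
  exact MeasurableSet.iUnion fun t => (measurableSet_exitType_eq x m' t).inter (measurableSet_digit_mem x m _)

end Summit.CriticalPhenomena.PercolationContinuityZ3.Theorems.FragileGiant
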